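import Summits.MatrixMultiplication.MatrixMultiplication.Theses.EisensteinValCertificates
import Summits.MatrixMultiplication.MatrixMultiplication.Theses.FourierTwoFamiliesModP
import Literature.Computability.AlgebraicComplexity.ChartUSP
import Literature.Computability.AlgebraicComplexity.SimultaneousDoubleProduct
import Summits.MatrixMultiplication.MatrixMultiplication.Theorems.EisensteinValCertificatesHomocyclicSTPPDesignsStubCornerFreeSquares
import Summits.MatrixMultiplication.MatrixMultiplication.Theorems.EisensteinValCertificatesHomocyclicSTPPDesignsStubChartPattern
import Summits.MatrixMultiplication.MatrixMultiplication.Theorems.EisensteinValCertificatesHomocyclicSTPPDesignsStubRowsDesign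
import Summits.MatrixMultiplication.MatrixMultiplication.Theorems.EisensteinValCertificatesHomocyclicSTPPDesignsStubRowsCount
import Summits.MatrixMultiplication.MatrixMultiplication.Theorems.EisensteinValCertificatesHomocyclicSTPPDesignsStubClusteredOfPrimeTwoFamilies
import Summits.MatrixMultiplication.MatrixMultiplication.Theorems.EisensteinValCertificatesHomocyclicSTPPDesignsStubLeafPacking
import Summits.MatrixMultiplication.MatrixMultiplication.Theorems.EisensteinValCertificatesHomocyclicSTPPDesignsStubLeafVersusPowerGain
import Summits.MatrixMultiplication.MatrixMultiplication.Theorems.EisensteinValCertificatesHomocyclicSTPPDesignsOfClusteredTwoFamilies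
import Summits.MatrixMultiplication.MatrixMultiplication.Theorems.EisensteinValCertificatesHomocyclicSTPPDesignsChartCapacity
import Summits.MatrixMultiplication.MatrixMultiplication.Theorems.EisensteinValCertificatesHomocyclicSTPPDesignsChartCapacityDensity
import Summits.MatrixMultiplication.MatrixMultiplication.Theorems.EisensteinValCertificatesHomocyclicSTPPDesignsBalancedLeaf
import Summits.MatrixMultiplication.MatrixMultiplication.Theorems.EisensteinValCertificatesHomocyclicSTPPDesignsLeafGivesDesigns
import Summits.MatrixMultiplication.MatrixMultiplication.Theorems.EisensteinValCertificatesHomocyclicSTPPDesignsNearPeriodPacking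
import Summits.MatrixMultiplication.MatrixMultiplication.Theorems.EisensteinValCertificatesHomocyclicSTPPDesignsCyclicReduction

set_option linter.dupNamespace false

/-!
# Crux `HomocyclicSTPPDesigns` (stmt-MatrixMultiplication-10647) — registered skeleton, lead c3 reshape, lead c5 by-name leaf

Route `EisensteinValCertificates`, crux `HomocyclicSTPPDesigns` = X′: for every `ε > 0` some prime power
`q`, some `ℓ` and some STPP family `(A_i,B_i,C_i)_{i<N}` in `(ℤ/q)^ℓ` (tree `IsSTPP`) with
`q^ℓ < Σ_i (|A_i||B_i||C_i|)^{(2+ε)/3}`.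

LEAD c5 (2026-08-17).  The one open stub is, since the rev-5 route repair, the route ITEM
stmt-MatrixMultiplication-18134 `EisensteinValCertificates.ClusteredTwoFamilies` (the registered signature verbatim, with
`A i - B i` spelled `Finset.image₂ (· - ·) (A i) (B i)` — definitionally equal, `Finset.sub = ⟨image₂ (· - ·)⟩`), so STUB 1
is now stated BY NAME (`theorem stub_clusteredTwoFamilies : ClusteredTwoFamilies`), exactly as the birth line stated its
leaf as `FourierTwoFamiliesModP.PrimeTwoFamilies` (= stmt-14308); the composition `HomocyclicSTPPDesigns_of` is unchanged
(the def unfolds), and the by-name glue `ClusteredTwoFamilies → HomocyclicSTPPDesigns` (= item stmt-18135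
`LeafGivesDesigns`, verbatim) is landed as `Theorems/…LeafGivesDesigns.lean`.

HISTORY.  The birth line (`Lines/birth.lean`, leads -0/c1/c2) is fully landed except for its one
crux-sized stub `stub_primeTwoFamilies : FourierTwoFamiliesModP.PrimeTwoFamilies` (= the open item
stmt-MatrixMultiplication-14308, CKSU Conj 4.7 at primes): `stub_designLift` p146750, the reduction
`PrimeTwoFamilies → HomocyclicSTPPDesigns` p149874, the large-block sandwich p150288/p150594/p151034.
Lead c3 RESHAPES that stub (L4) using the crux strategist's kernel-checked composition
`Lines/clustered_charts.lean` (idea `clustered-chart-amplification`, STRATEGY-CENSUS TS3): the open leaf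
becomes `stub_clusteredTwoFamilies`, which is IMPLIED by `PrimeTwoFamilies` (calibration stub
`stub_clusteredOfPrimeTwoFamilies`, provable now) and not known to imply it; everything else is provable.

THE LINE (clustered chart amplification).  CKSU 2005 Thm 37 (tree `CohnKleinbergSzegedyUmans2005_thm37`)
turns a local 𝒞-USP over an `H`-chart into an STPP family in `H^k`.  Chart: the symbols of an SDPP family
`(A_t,B_t)_{t<n}` in `ℤ/p` in three rotated roles `(A_t,B_t,{0})`, `({0},A_t,B_t)`, `(B_t,{0},A_t)`
(symbol set `Fin n × Fin 3`; clause (W) makes each symbol TPP).  PATTERN (`stub_chartPattern`, from clause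
(X)): at a coordinate where the three rows `u,v,w` carry role `r`, the `IsSTPP` relation can hold
(= the symbol triple `(u_c,v_c,w_c)` is NOT in `chartHypergraph`) only if
  role 0: `u_c = w_c` and `(A−B)(u_c) ∩ (A−B)(v_c) ≠ ∅`;   role 1: `u_c = v_c` and `(A−B)(u_c) ∩ (A−B)(w_c) ≠ ∅`;
  role 2: `v_c = w_c` and `(A−B)(v_c) ∩ (A−B)(u_c) ≠ ∅`.
So if the index set is partitioned into `m` classes with cross-class DISJOINT difference sets `A_t − B_t`
("clustered"), every class of size `≥ d ≥ 1`, take width `k = 3t`, roles `r` on the block `R_r` of `t`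
coordinates, and rows indexed by (class word `κ ∈ (Fin m)^{3t}`, FREE) × (value pair `(X,Y) ∈ S`,
`S ⊆ ℤ_D × ℤ_D`, `D = d^t`), the row carrying at coordinate `(r,τ)` the member number `digit_τ(V_r)` of
class `κ_{(r,τ)}` where `V_0 = X`, `V_1 = Y`, `V_2 = −X−Y` (digits via any bijection `ℤ_D ≃ (Fin d)^t`,
members via any injection `Fin d ↪ class`).  A violating triple `u,v,w` (all coordinates bad) has ONE
common class word and `X_u = X_w`, `Y_u = Y_v`, `X_v+Y_v = X_w+Y_w`, i.e. with `δ := X_v − X_u` the three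
value pairs are `(X,Y) = u`, `(X+δ,Y) = v`, `(X,Y+δ) = w` — the corner `{(x,y),(x+δ',y),(x+δ',y−δ')}` based
at `v` with `δ' = −δ`; a corner-free square `S` (`stub_cornerFreeSquares`, Behrend) forces `δ = 0`, `u=v=w`.
Rows `L = m^{3t}·|S|`, every block has volume `(ab)^{3t}` (`stub_rowsDesign`, via Thm 37).  COUNT
(`stub_rowsCount`): with MERIT `m·d^{2/3}·(ab)^{(2+ε)/3} > p` the designs in `(ℤ/p)^{3t}` beat `2+2ε`
for `t` large (`(ab)^{ε/3} > 1` pays the `k`-th root of the Behrend loss).  EXISTENCE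
(`stub_clusteredTwoFamilies`, OPEN — the line's bet): clustered SDPP families with merit for every `ε`;
for one class (`m = 1`, `d = n`) this is CKSU Conj 4.7 at primes up to uniformisation
(`stub_clusteredOfPrimeTwoFamilies`).

CAPACITY (lead c4, 2026-08-17; `Cruxes/HomocyclicSTPPDesigns/CHART-CAPACITY.md`).  The one reshape lever of a
line lead — replace the row design (stubs 2–5) by a cleverer one over the SAME chart so that stub 1
gets weaker — is closed for the density clause: EVERY local chart-USP over the rotated chart of an SDPP
family has `L³·(ab)^k ≤ n^{2k}·p^k` (fixed role layout; per role `L(ab)^{k_r} ≤ n^{k'_r} p^{k_r}` by a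
double count over the test triples `(u,v,u)`/`(u,u,v)`/`(v,u,u)`) and `≤ 27^k n^{2k} p^k` for arbitrary
rows, so blocks beating `2+ε` force `p² < [27] n² (ab)^{1+ε}`, i.e. `σ₁ = p²/(n²ab) < [27](ab)^ε`
(LANDED p159353 `chartCapacity_rows_le`/`chartCapacity_rows_cube_le`/`chartCapacity_cube`, p159568
`chartCapacity_rows_cube_le_mixed`/`chartCapacity_designs_need_density[_mixed]`/`chartCapacity_needDensity[_mixed]`).
The class-word × corner-free design attains the bound exactly when the class tiling is tight
(`σ₂ = p/(m·ab) ≈ 1`): stub 1 is the weakest open stub this mechanism admits, up to σ₂ bookkeeping, and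
the kill item 14309 obstructs the whole mechanism.  BALANCED NORMAL FORM (LANDED p159859,
`clusteredTwoFamilies_iff_balanced`): stub 1 ⟺ the same with `|A_i| = |B_i| = s ≥ 2` and merit
`m·d^{2/3}·(s·s)^{(2+ε)/3} > p` (the vocabulary of 14309/14310/14311).

STUBS: composition stubs `stub_clusteredTwoFamilies` (OPEN — the only `sorry` left),
`stub_cornerFreeSquares` (LANDED p153638), `stub_chartPattern` (LANDED p153566), `stub_rowsDesign`
(LANDED p153980; takes the pattern statement as hypothesis), `stub_rowsCount` (LANDED p153798);
calibration stubs (not used by the composition) `stub_clusteredOfPrimeTwoFamilies` (LANDED p154020: old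
leaf ⟹ new leaf), `stub_leafPacking` (LANDED p155654), `stub_leafSwap` (LANDED p155479),
`stub_leafVersusPowerGain` (LANDED p155804: PrimeCyclicPowerGain ⟹ ¬ leaf); capacity / normal-form
calibration (lead c4, registered via `workitem stub-add`, all LANDED): `chartCapacity_cube` (p159353),
`chartCapacity_cube_mixed`, `chartCapacity_needDensity`, `chartCapacity_needDensity_mixed` (p159568),
`clusteredTwoFamilies_iff_balanced` (p159859).  Composition
`designs_of_parts` (real proof) and `HomocyclicSTPPDesigns_of : HomocyclicSTPPDesigns` conclude the crux
BY NAME; the composition is also landed as the reduction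
`Theorems/…OfClusteredTwoFamilies.lean: homocyclicSTPPDesigns_of_clusteredTwoFamilies` (p155276), and the
kill-side assembly as `Theorems/…LeafSandwich.lean: not_clusteredTwoFamilies_of_primeCyclicPowerGain` (p156608).
SANDWICH (all landed): PrimeTwoFamilies (stmt-14308) ⟹ leaf ⟹ X′ (stmt-10647);
PrimeCyclicPowerGain (stmt-14309) ⟹ ¬leaf; NoHomocyclicSTPP (stmt-7787) ⟹ ¬leaf.
-/

namespace Summit.MatrixMultiplication.MatrixMultiplication.Cruxes.HomocyclicSTPPDesigns.ClusteredCharts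

open Summit.MatrixMultiplication.MatrixMultiplication.Theses.EisensteinValCertificates
open Summit.MatrixMultiplication.MatrixMultiplication.Theses.FourierTwoFamiliesModP (PrimeTwoFamilies
  PrimeCyclicPowerGain)
open Literature.Computability.AlgebraicComplexity Finset
open scoped BigOperators Pointwise

/-! ## The stubs -/

/-- STUB 1 — **clustered two families** (OPEN existence statement; the line's bet), stated BY NAME: it IS
the route item stmt-MatrixMultiplication-18134 `EisensteinValCertificates.ClusteredTwoFamilies` (promoted from this
skeleton at the rev-5 repair; implied by `PrimeTwoFamilies` = stmt-14308 via `stub_clusteredOfPrimeTwoFamilies`).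
For every `ε > 0`: a prime `p`, an SDPP family `(A_t, B_t)_{t<n}` in `ℤ/p` (tree `IsSDPP`) with
`|A_t| = a`, `|B_t| = b`, `ab ≥ 2`, and a class map `cls : Fin n → Fin m` such that difference sets
`A_t − B_t` (route file: `Finset.image₂ (· - ·) (A t) (B t)`, defeq) of different classes are DISJOINT and
every class has `≥ d` members, with MERIT `m · d^{2/3} · (ab)^{(2+ε)/3} > p`. -/
theorem stub_clusteredTwoFamilies : ClusteredTwoFamilies := by
  sorry

/-- By-name typing of STUB 1: the route `def` unfolds (definitionally, `Finset.sub = ⟨image₂ (· - ·)⟩`) to the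
signature registered by leads c3/c4. -/
example : ClusteredTwoFamilies ↔
    ∀ ε : ℝ, 0 < ε → ∃ p : ℕ, p.Prime ∧ ∃ (n m a b d : ℕ) (A B : Fin n → Finset (ZMod p))
      (cls : Fin n → Fin m), IsSDPP A B ∧ 2 ≤ a * b ∧ (∀ i, (A i).card = a ∧ (B i).card = b) ∧
      (∀ i j, cls i ≠ cls j → Disjoint (A i - B i) (A j - B j)) ∧
      (∀ c : Fin m, d ≤ (Finset.univ.filter fun i => cls i = c).card) ∧
      (p : ℝ) < (m : ℝ) * (d : ℝ) ^ ((2 : ℝ) / 3) * ((a * b : ℕ) : ℝ) ^ ((2 + ε) / 3) :=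
  Iff.rfl

/-- STUB 2 — **corner-free squares** (KNOWN, Behrend; size M): for every `η > 0` and all large `D`, a
subset of `ℤ_D × ℤ_D` of size `≥ D^{2−η}` without the pattern `{(x,y),(x+δ,y),(x+δ,y−δ)}`, `δ ≠ 0`.
Recipe: `S = {(x, t − 2x) : x ∈ ℤ_D, t ∈ T}` with `T ⊆ [0, D/2)` free of 3-term progressions
(`rothNumberNat`, tree `exists_threeAPFree_card_ge_rpow`): the three points have `2x+y`-values
`L, L+2δ, L+δ`, a 3-AP of residues lying in `[0, D/2)`, hence a genuine 3-AP in `T`. -/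
theorem stub_cornerFreeSquares :
    ∀ η : ℝ, 0 < η → ∃ D₀ : ℕ, ∀ D ≥ D₀, ∃ S : Finset (ZMod D × ZMod D),
      (∀ x y δ : ZMod D, (x, y) ∈ S → (x + δ, y) ∈ S → (x + δ, y - δ) ∈ S → δ = 0) ∧
      (D : ℝ) ^ (2 - η) ≤ S.card -- LANDED (p153638)
  :=
  Summit.MatrixMultiplication.MatrixMultiplication.Theorems.HomocyclicSTPPDesigns.ClusteredCharts.stub_cornerFreeSquares

/-- STUB 3 — **the chart pattern** (size S/M; clause (X) of the SDPP, three rotations): at a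
role-`r` coordinate the `IsSTPP` relation set of the symbol triple (= the complement of CKSU's chart
hypergraph, tree `chartHypergraph`, for the chart `(A_t,B_t,{0}) / ({0},A_t,B_t) / (B_t,{0},A_t)`)
contains `0` only if two of the three indices coincide and the third index's difference set meets theirs. -/
theorem stub_chartPattern :
    ∀ (p n : ℕ) (A B : Fin n → Finset (ZMod p)), IsSDPP A B → ∀ t₁ t₂ t₃ : Fin n,
      ((0 : ZMod p) ∈ (A t₁ - A t₂) + (B t₂ - B t₃) + (({0} : Finset (ZMod p)) - {0}) →
          t₁ = t₃ ∧ ¬ Disjoint (A t₁ - B t₁) (A t₂ - B t₂)) ∧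
      ((0 : ZMod p) ∈ (({0} : Finset (ZMod p)) - {0}) + (A t₂ - A t₃) + (B t₃ - B t₁) →
          t₂ = t₁ ∧ ¬ Disjoint (A t₂ - B t₂) (A t₃ - B t₃)) ∧
      ((0 : ZMod p) ∈ (B t₁ - B t₂) + (({0} : Finset (ZMod p)) - {0}) + (A t₃ - A t₁) →
          t₃ = t₂ ∧ ¬ Disjoint (A t₃ - B t₃) (A t₁ - B t₁)) -- LANDED (p153566)
  :=
  Summit.MatrixMultiplication.MatrixMultiplication.Theorems.HomocyclicSTPPDesigns.ClusteredCharts.stub_chartPattern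

/-- STUB 4 — **rows ⟹ designs** (the line's NEW combinatorial theorem; size L; takes the pattern
statement of `stub_chartPattern` as hypothesis).  Given a clustered SDPP family (cross-class disjoint
difference sets, classes of size `≥ d ≥ 1`, uniform `|A_t| = a`, `|B_t| = b`) and a corner-free
`S ⊆ ℤ_{d^t} × ℤ_{d^t}`, there is an STPP family of `L ≥ m^{3t}·|S|` triples in `Fin (3t) → ZMod p`,
every triple of volume `(ab)^{3t}`.  Proof = the rows of the module docstring (class word free × value
pairs in `S`, member numbers = digits) form a local chart-USP (`IsLocalChartUSP`) for the rotated SDPP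
chart, which is an `H`-chart by clause (W); CKSU Thm 37 (`CohnKleinbergSzegedyUmans2005_thm37`) makes the
product blocks (`chartBlock`, `Fintype.card_piFinset`) an `IsSTPP` family. -/
theorem stub_rowsDesign :
    (∀ (p n : ℕ) (A B : Fin n → Finset (ZMod p)), IsSDPP A B → ∀ t₁ t₂ t₃ : Fin n,
      ((0 : ZMod p) ∈ (A t₁ - A t₂) + (B t₂ - B t₃) + (({0} : Finset (ZMod p)) - {0}) →
          t₁ = t₃ ∧ ¬ Disjoint (A t₁ - B t₁) (A t₂ - B t₂)) ∧
      ((0 : ZMod p) ∈ (({0} : Finset (ZMod p)) - {0}) + (A t₂ - A t₃) + (B t₃ - B t₁) →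
          t₂ = t₁ ∧ ¬ Disjoint (A t₂ - B t₂) (A t₃ - B t₃)) ∧
      ((0 : ZMod p) ∈ (B t₁ - B t₂) + (({0} : Finset (ZMod p)) - {0}) + (A t₃ - A t₁) →
          t₃ = t₂ ∧ ¬ Disjoint (A t₃ - B t₃) (A t₁ - B t₁))) →
    ∀ (p n m d : ℕ) (A B : Fin n → Finset (ZMod p)) (cls : Fin n → Fin m),
      IsSDPP A B → (∀ i j, cls i ≠ cls j → Disjoint (A i - B i) (A j - B j)) →
      1 ≤ d → (∀ c : Fin m, d ≤ (Finset.univ.filter fun i => cls i = c).card) →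
      ∀ (a b : ℕ), (∀ i, (A i).card = a ∧ (B i).card = b) →
      ∀ (t : ℕ) (S : Finset (ZMod (d ^ t) × ZMod (d ^ t))),
        (∀ x y δ : ZMod (d ^ t), (x, y) ∈ S → (x + δ, y) ∈ S → (x + δ, y - δ) ∈ S → δ = 0) →
        ∃ (L : ℕ) (A' B' C' : Fin L → Finset (Fin (3 * t) → ZMod p)),
          IsSTPP A' B' C' ∧ m ^ (3 * t) * S.card ≤ L ∧
          ∀ u, (A' u).card * (B' u).card * (C' u).card = (a * b) ^ (3 * t) -- LANDED (p153980)
  :=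
  Summit.MatrixMultiplication.MatrixMultiplication.Theorems.HomocyclicSTPPDesigns.ClusteredCharts.stub_rowsDesign

/-- STUB 5 — **the count** (size M; pure `rpow` bookkeeping, the STPP family is passed through):
corner-free squares of size `D^{2−η}` and rows⟹designs at every width `3t` turn MERIT
`m·d^{2/3}·(ab)^{(2+ε)/3} > p` into designs in `(ℤ/p)^{3t}` beating `2+2ε`: with `D = d^t`,
`L·(ab)^{t(2+2ε)} ≥ m^{3t} d^{t(2−η)} (ab)^{t(2+2ε)} ≥ m^{3t} d^{2t} (ab)^{t(2+ε)} > p^{3t}` as soon as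
`d^η ≤ (ab)^ε` (`d = 1`: any `t ≥ 1` with `S = {(0,0)}`; `d ≥ 2`: `η ≤ ε·log(ab)/log d`, `t` with `d^t ≥ D₀`). -/
theorem stub_rowsCount :
    (∀ η : ℝ, 0 < η → ∃ D₀ : ℕ, ∀ D ≥ D₀, ∃ S : Finset (ZMod D × ZMod D),
      (∀ x y δ : ZMod D, (x, y) ∈ S → (x + δ, y) ∈ S → (x + δ, y - δ) ∈ S → δ = 0) ∧
      (D : ℝ) ^ (2 - η) ≤ S.card) →
    ∀ (p m a b d : ℕ), 2 ≤ a * b → 1 ≤ d →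
      (∀ (t : ℕ) (S : Finset (ZMod (d ^ t) × ZMod (d ^ t))),
        (∀ x y δ : ZMod (d ^ t), (x, y) ∈ S → (x + δ, y) ∈ S → (x + δ, y - δ) ∈ S → δ = 0) →
        ∃ (L : ℕ) (A' B' C' : Fin L → Finset (Fin (3 * t) → ZMod p)),
          IsSTPP A' B' C' ∧ m ^ (3 * t) * S.card ≤ L ∧
          ∀ u, (A' u).card * (B' u).card * (C' u).card = (a * b) ^ (3 * t)) →
      ∀ ε : ℝ, 0 < ε →
      (p : ℝ) < (m : ℝ) * (d : ℝ) ^ ((2 : ℝ) / 3) * ((a * b : ℕ) : ℝ) ^ ((2 + ε) / 3) →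
      ∃ (ℓ N : ℕ) (A' B' C' : Fin N → Finset (Fin ℓ → ZMod p)),
        IsSTPP A' B' C' ∧ (p : ℝ) ^ ℓ <
          ∑ u, (((A' u).card * (B' u).card * (C' u).card : ℕ) : ℝ) ^ ((2 + 2 * ε) / 3) -- LANDED (p153798)
  :=
  Summit.MatrixMultiplication.MatrixMultiplication.Theorems.HomocyclicSTPPDesigns.ClusteredCharts.stub_rowsCount

/-- STUB 6 — **calibration: the old leaf implies the new one** (size M; not used by the composition;
records that the reshape weakened the line's open stub).  `PrimeTwoFamilies` (stmt-14308: for every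
`δ > 0` and arbitrarily large `n`, a prime `p ≤ n^{2+δ}` and `n` SDPP pairs in `ℤ/p` with
`|A_i||B_i| ≥ n^{2−δ}`) gives the one-class case of STUB 1: dyadic pigeonhole on `|A_i|`
(`≤ log₂ p + 2 ≤ n^δ` classes for large `n`), shrink to `|A_i| = a = 2^s`, `|B_i| = b` exactly
(`Finset.exists_subset_card_eq`, `IsSDPP.mono`, `IsSDPP.reindex`), `m = 1`, `cls = 0`, `d = n'`;
merit `n'^{2/3}(ab)^{(2+ε)/3} ≥ n^{(2/3)(1−δ)}(n^{2−δ}/4)^{(2+ε)/3} > n^{2+δ} ≥ p` for `δ = min(ε,1)/8`. -/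
theorem stub_clusteredOfPrimeTwoFamilies :
    PrimeTwoFamilies →
    ∀ ε : ℝ, 0 < ε → ∃ p : ℕ, p.Prime ∧ ∃ (n m a b d : ℕ) (A B : Fin n → Finset (ZMod p))
      (cls : Fin n → Fin m), IsSDPP A B ∧ 2 ≤ a * b ∧ (∀ i, (A i).card = a ∧ (B i).card = b) ∧
      (∀ i j, cls i ≠ cls j → Disjoint (A i - B i) (A j - B j)) ∧
      (∀ c : Fin m, d ≤ (Finset.univ.filter fun i => cls i = c).card) ∧
      (p : ℝ) < (m : ℝ) * (d : ℝ) ^ ((2 : ℝ) / 3) * ((a * b : ℕ) : ℝ) ^ ((2 + ε) / 3) -- LANDED (p154020)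
  :=
  Summit.MatrixMultiplication.MatrixMultiplication.Theorems.HomocyclicSTPPDesigns.ClusteredCharts.stub_clusteredOfPrimeTwoFamilies

/-! ## Kill-side calibration stubs (lead c3, wave 2): the leaf versus `PrimeCyclicPowerGain`

Not used by the composition.  They place STUB 1 between the two open items of route
FourierTwoFamiliesModP: `PrimeTwoFamilies ⟹ leaf` (STUB 6) and `PrimeCyclicPowerGain ⟹ ¬ leaf`
(STUB 9, from STUBS 7–8), i.e. stmt-14309 refutes the leaf — the strategist's claim, with the balancing
subtlety (14309 is about BALANCED configurations `|A_i| = |B_i| = s`) handled by the packing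
comparability `b^{1−ε} < a^{1+ε}` of leaf witnesses. -/

/-- STUB 7 — **packing inequalities of a clustered SDPP family** (size M, elementary): with
`|A_i| = a ≥ 1`, `|B_i| = b ≥ 1`, classes of size `≥ d ≥ 1` and cross-class disjoint difference sets
in `ℤ/p`: the `A_i` are pairwise disjoint (`n·a ≤ p`), so are the `B_i` (`n·b ≤ p`); one difference
set per class, each of size `ab` by clause (W), pairwise disjoint (`m·ab ≤ p`); `m·d ≤ n`; and the
refined packings `(n−1)·a + m·ab ≤ p`, `(n−1)·b + m·ab ≤ p`: for a fixed `k` and `b₀ ∈ B_k` the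
translate `(⋃_{i≠k} A_i) − b₀` misses EVERY `A_j − B_j` by clause (X) (`a_i − b₀ = a'_j − b_j` forces
`i = k`), and symmetrically `a₀ − ⋃_{i≠k} B_i`. -/
theorem stub_leafPacking :
    ∀ (p n m a b d : ℕ), p.Prime → ∀ (A B : Fin n → Finset (ZMod p)) (cls : Fin n → Fin m),
      IsSDPP A B → 1 ≤ a → 1 ≤ b → (∀ i, (A i).card = a ∧ (B i).card = b) →
      (∀ i j, cls i ≠ cls j → Disjoint (A i - B i) (A j - B j)) →
      1 ≤ d → (∀ c : Fin m, d ≤ (Finset.univ.filter fun i => cls i = c).card) →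
      n * a ≤ p ∧ n * b ≤ p ∧ m * (a * b) ≤ p ∧ m * d ≤ n ∧
      (n - 1) * a + m * (a * b) ≤ p ∧ (n - 1) * b + m * (a * b) ≤ p -- LANDED (p155654)
  :=
  Summit.MatrixMultiplication.MatrixMultiplication.Theorems.HomocyclicSTPPDesigns.ClusteredCharts.stub_leafPacking

/-- STUB 8 — **swap symmetry** (size S): swapping the roles of `A` and `B` preserves the SDPP
(clause (W) by commutativity, clause (X) by negating the relation and reading it at `(k, j, i)`) and
the clustering (`B_i − A_i = −(A_i − B_i)`). -/
theorem stub_leafSwap :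
    ∀ (p n m : ℕ) (A B : Fin n → Finset (ZMod p)) (cls : Fin n → Fin m),
      IsSDPP A B → (∀ i j, cls i ≠ cls j → Disjoint (A i - B i) (A j - B j)) →
      IsSDPP B A ∧ (∀ i j, cls i ≠ cls j → Disjoint (B i - A i) (B j - A j)) := by
  -- LANDED (p155479) as `Theorems…StubLeafSwap.lean: ClusteredCharts.stub_leafSwap`; re-proved inline here
  -- (same proof) so that this workfile's import closure avoids that module.
  intro p n m A B cls hS hD
  refine ⟨⟨fun i b hb b' hb' a ha a' ha' h0 => ?_, fun i j k b hb b' hb' a ha a' ha' h0 => ?_⟩,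
    fun i j hij => ?_⟩
  · rw [add_comm] at h0
    obtain ⟨h1, h2⟩ := hS.dpp i ha ha' hb hb' h0
    exact ⟨h2, h1⟩
  · have h0' : (a' - a) + (b' - b) = 0 := by
      rw [← neg_eq_zero, ← h0]
      abel
    exact (hS.simultaneous ha' ha hb' hb h0').symm
  · have h := hD i j hij
    rw [Finset.disjoint_left] at h ⊢
    intro x hx hx'
    rw [Finset.mem_sub] at hx hx'
    obtain ⟨b, hb, a, ha, rfl⟩ := hx
    obtain ⟨b', hb', a', ha', he⟩ := hx'
    refine h (Finset.sub_mem_sub ha hb) ?_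
    have he' : a - b = a' - b' := by
      rw [← neg_sub b a, ← he, neg_sub]
    rw [he']
    exact Finset.sub_mem_sub ha' hb'

/-- STUB 9 — **`PrimeCyclicPowerGain` refutes the leaf** (size L; takes STUBS 7–8 as hypotheses).
With `⟨c, s₀⟩` from `PrimeCyclicPowerGain` take a leaf witness at
`ε := min (c/4) (min (1/8) ε₁(s₀))`.  Packing + merit cubed: `p³ < m n² (ab)^{2+ε}`; `n = 1` is
impossible and for `n ≥ 2` the refined packings give `(ab)^ε > 27/16` (`4Y(1−Y)² ≤ 16/27`); WLOG
`a ≤ b` (STUB 8); `p² < n²(ab)^{1+ε}` and `n ≤ p/b` give `b^{1−ε} < a^{1+ε}`, so `a ≥ s₀`; shrink the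
`B_i` to size `a` and apply the power gain: `n a^{1+c} ≤ p`, whence `a^{c − 16ε/7} < 1` with `a ≥ 2`,
a contradiction. -/
theorem stub_leafVersusPowerGain :
    (∀ (p n m a b d : ℕ), p.Prime → ∀ (A B : Fin n → Finset (ZMod p)) (cls : Fin n → Fin m),
      IsSDPP A B → 1 ≤ a → 1 ≤ b → (∀ i, (A i).card = a ∧ (B i).card = b) →
      (∀ i j, cls i ≠ cls j → Disjoint (A i - B i) (A j - B j)) →
      1 ≤ d → (∀ c : Fin m, d ≤ (Finset.univ.filter fun i => cls i = c).card) →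
      n * a ≤ p ∧ n * b ≤ p ∧ m * (a * b) ≤ p ∧ m * d ≤ n ∧
      (n - 1) * a + m * (a * b) ≤ p ∧ (n - 1) * b + m * (a * b) ≤ p) →
    (∀ (p n m : ℕ) (A B : Fin n → Finset (ZMod p)) (cls : Fin n → Fin m),
      IsSDPP A B → (∀ i j, cls i ≠ cls j → Disjoint (A i - B i) (A j - B j)) →
      IsSDPP B A ∧ (∀ i j, cls i ≠ cls j → Disjoint (B i - A i) (B j - A j))) →
    PrimeCyclicPowerGain →
    ¬ ∀ ε : ℝ, 0 < ε → ∃ p : ℕ, p.Prime ∧ ∃ (n m a b d : ℕ) (A B : Fin n → Finset (ZMod p))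
      (cls : Fin n → Fin m), IsSDPP A B ∧ 2 ≤ a * b ∧ (∀ i, (A i).card = a ∧ (B i).card = b) ∧
      (∀ i j, cls i ≠ cls j → Disjoint (A i - B i) (A j - B j)) ∧
      (∀ c : Fin m, d ≤ (Finset.univ.filter fun i => cls i = c).card) ∧
      (p : ℝ) < (m : ℝ) * (d : ℝ) ^ ((2 : ℝ) / 3) * ((a * b : ℕ) : ℝ) ^ ((2 + ε) / 3) -- LANDED (p155804)
  :=
  Summit.MatrixMultiplication.MatrixMultiplication.Theorems.HomocyclicSTPPDesigns.ClusteredCharts.stub_leafVersusPowerGain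

/-! ## Composition (real proofs) -/

/-- PROVED: the composition of the stub STATEMENTS 1–5 into the crux text (verbatim): stub 1 at `ε/2`
gives a clustered family with merit; `d ≥ 1` because the merit is strict; stubs 3–4 give designs at
every width `3t`, stub 5 (fed with stub 2) picks the width; `q := p`, `ℓ := 3t`. -/
theorem designs_of_parts
    (h1 : ∀ ε : ℝ, 0 < ε → ∃ p : ℕ, p.Prime ∧ ∃ (n m a b d : ℕ) (A B : Fin n → Finset (ZMod p))
      (cls : Fin n → Fin m), IsSDPP A B ∧ 2 ≤ a * b ∧ (∀ i, (A i).card = a ∧ (B i).card = b) ∧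
      (∀ i j, cls i ≠ cls j → Disjoint (A i - B i) (A j - B j)) ∧
      (∀ c : Fin m, d ≤ (Finset.univ.filter fun i => cls i = c).card) ∧
      (p : ℝ) < (m : ℝ) * (d : ℝ) ^ ((2 : ℝ) / 3) * ((a * b : ℕ) : ℝ) ^ ((2 + ε) / 3))
    (h2 : ∀ η : ℝ, 0 < η → ∃ D₀ : ℕ, ∀ D ≥ D₀, ∃ S : Finset (ZMod D × ZMod D),
      (∀ x y δ : ZMod D, (x, y) ∈ S → (x + δ, y) ∈ S → (x + δ, y - δ) ∈ S → δ = 0) ∧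
      (D : ℝ) ^ (2 - η) ≤ S.card)
    (h3 : ∀ (p n : ℕ) (A B : Fin n → Finset (ZMod p)), IsSDPP A B → ∀ t₁ t₂ t₃ : Fin n,
      ((0 : ZMod p) ∈ (A t₁ - A t₂) + (B t₂ - B t₃) + (({0} : Finset (ZMod p)) - {0}) →
          t₁ = t₃ ∧ ¬ Disjoint (A t₁ - B t₁) (A t₂ - B t₂)) ∧
      ((0 : ZMod p) ∈ (({0} : Finset (ZMod p)) - {0}) + (A t₂ - A t₃) + (B t₃ - B t₁) →
          t₂ = t₁ ∧ ¬ Disjoint (A t₂ - B t₂) (A t₃ - B t₃)) ∧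
      ((0 : ZMod p) ∈ (B t₁ - B t₂) + (({0} : Finset (ZMod p)) - {0}) + (A t₃ - A t₁) →
          t₃ = t₂ ∧ ¬ Disjoint (A t₃ - B t₃) (A t₁ - B t₁)))
    (h4 : (∀ (p n : ℕ) (A B : Fin n → Finset (ZMod p)), IsSDPP A B → ∀ t₁ t₂ t₃ : Fin n,
      ((0 : ZMod p) ∈ (A t₁ - A t₂) + (B t₂ - B t₃) + (({0} : Finset (ZMod p)) - {0}) →
          t₁ = t₃ ∧ ¬ Disjoint (A t₁ - B t₁) (A t₂ - B t₂)) ∧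
      ((0 : ZMod p) ∈ (({0} : Finset (ZMod p)) - {0}) + (A t₂ - A t₃) + (B t₃ - B t₁) →
          t₂ = t₁ ∧ ¬ Disjoint (A t₂ - B t₂) (A t₃ - B t₃)) ∧
      ((0 : ZMod p) ∈ (B t₁ - B t₂) + (({0} : Finset (ZMod p)) - {0}) + (A t₃ - A t₁) →
          t₃ = t₂ ∧ ¬ Disjoint (A t₃ - B t₃) (A t₁ - B t₁))) →
    ∀ (p n m d : ℕ) (A B : Fin n → Finset (ZMod p)) (cls : Fin n → Fin m),
      IsSDPP A B → (∀ i j, cls i ≠ cls j → Disjoint (A i - B i) (A j - B j)) →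
      1 ≤ d → (∀ c : Fin m, d ≤ (Finset.univ.filter fun i => cls i = c).card) →
      ∀ (a b : ℕ), (∀ i, (A i).card = a ∧ (B i).card = b) →
      ∀ (t : ℕ) (S : Finset (ZMod (d ^ t) × ZMod (d ^ t))),
        (∀ x y δ : ZMod (d ^ t), (x, y) ∈ S → (x + δ, y) ∈ S → (x + δ, y - δ) ∈ S → δ = 0) →
        ∃ (L : ℕ) (A' B' C' : Fin L → Finset (Fin (3 * t) → ZMod p)),
          IsSTPP A' B' C' ∧ m ^ (3 * t) * S.card ≤ L ∧
          ∀ u, (A' u).card * (B' u).card * (C' u).card = (a * b) ^ (3 * t))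
    (h5 : (∀ η : ℝ, 0 < η → ∃ D₀ : ℕ, ∀ D ≥ D₀, ∃ S : Finset (ZMod D × ZMod D),
      (∀ x y δ : ZMod D, (x, y) ∈ S → (x + δ, y) ∈ S → (x + δ, y - δ) ∈ S → δ = 0) ∧
      (D : ℝ) ^ (2 - η) ≤ S.card) →
    ∀ (p m a b d : ℕ), 2 ≤ a * b → 1 ≤ d →
      (∀ (t : ℕ) (S : Finset (ZMod (d ^ t) × ZMod (d ^ t))),
        (∀ x y δ : ZMod (d ^ t), (x, y) ∈ S → (x + δ, y) ∈ S → (x + δ, y - δ) ∈ S → δ = 0) →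
        ∃ (L : ℕ) (A' B' C' : Fin L → Finset (Fin (3 * t) → ZMod p)),
          IsSTPP A' B' C' ∧ m ^ (3 * t) * S.card ≤ L ∧
          ∀ u, (A' u).card * (B' u).card * (C' u).card = (a * b) ^ (3 * t)) →
      ∀ ε : ℝ, 0 < ε →
      (p : ℝ) < (m : ℝ) * (d : ℝ) ^ ((2 : ℝ) / 3) * ((a * b : ℕ) : ℝ) ^ ((2 + ε) / 3) →
      ∃ (ℓ N : ℕ) (A' B' C' : Fin N → Finset (Fin ℓ → ZMod p)),
        IsSTPP A' B' C' ∧ (p : ℝ) ^ ℓ <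
          ∑ u, (((A' u).card * (B' u).card * (C' u).card : ℕ) : ℝ) ^ ((2 + 2 * ε) / 3)) :
    ∀ ε : ℝ, 0 < ε → ∃ q ℓ : ℕ, IsPrimePow q ∧ ∃ (N : ℕ) (A B C : Fin N → Finset (Fin ℓ → ZMod q)),
      IsSTPP A B C ∧ (q : ℝ) ^ ℓ <
        ∑ i, (((A i).card * (B i).card * (C i).card : ℕ) : ℝ) ^ ((2 + ε) / 3) := by
  intro ε hε
  obtain ⟨p, hp, n, m, a, b, d, A, B, cls, hS, hab, hcard, hdisj, hd, hmerit⟩ :=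
    h1 (ε / 2) (half_pos hε)
  -- the merit is strict, so `d ≥ 1`
  have hd1 : 1 ≤ d := by
    rcases Nat.eq_zero_or_pos d with h0 | hpos
    · exfalso
      subst h0
      have hz : ((0 : ℕ) : ℝ) ^ ((2 : ℝ) / 3) = 0 := by
        rw [Nat.cast_zero]
        exact Real.zero_rpow (by norm_num)
      rw [hz, mul_zero, zero_mul] at hmerit
      exact absurd hmerit (not_lt.mpr (Nat.cast_nonneg p))
    · exact hpos
  obtain ⟨ℓ, N, A', B', C', hSTPP, hlt⟩ :=
    h5 h2 p m a b d hab hd1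
      (fun t S hSc => h4 h3 p n m d A B cls hS hdisj hd1 hd a b hcard t S hSc)
      (ε / 2) (half_pos hε) hmerit
  refine ⟨p, ℓ, hp.isPrimePow, N, A', B', C', hSTPP, ?_⟩
  have hexp : (2 + 2 * (ε / 2)) / 3 = (2 + ε) / 3 := by ring
  rw [hexp] at hlt
  exact hlt

/-- By-name typing of the composition (the crux `def` unfolds to the conclusion of `designs_of_parts`). -/
example : HomocyclicSTPPDesigns =
    ∀ ε : ℝ, 0 < ε → ∃ q ℓ : ℕ, IsPrimePow q ∧ ∃ (N : ℕ) (A B C : Fin N → Finset (Fin ℓ → ZMod q)),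
      IsSTPP A B C ∧ (q : ℝ) ^ ℓ <
        ∑ i, (((A i).card * (B i).card * (C i).card : ℕ) : ℝ) ^ ((2 + ε) / 3) := rfl

/-- THE SKELETON THEOREM — concludes the crux `EisensteinValCertificates.HomocyclicSTPPDesigns` BY NAME
from the registered stubs 1–5 (sorries only inside `stub_*`; stub 6 is calibration only; stub 1 is the route
item `ClusteredTwoFamilies`, whose `def` unfolds to hypothesis `h1` of `designs_of_parts`). -/
theorem HomocyclicSTPPDesigns_of : HomocyclicSTPPDesigns :=
  designs_of_parts stub_clusteredTwoFamilies stub_cornerFreeSquares stub_chartPattern stub_rowsDesign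
    stub_rowsCount

/-- The by-name glue (= item stmt-MatrixMultiplication-18135 `LeafGivesDesigns`, verbatim `ClusteredTwoFamilies →
HomocyclicSTPPDesigns`), through this skeleton's composition; landed from the tree reduction p155276 as
`Theorems/EisensteinValCertificatesHomocyclicSTPPDesignsLeafGivesDesigns.lean`. -/
theorem leafGivesDesigns_skeleton : LeafGivesDesigns := fun h =>
  designs_of_parts h stub_cornerFreeSquares stub_chartPattern stub_rowsDesign stub_rowsCount

/-- Calibration, typed: the birth line's open stub implies this line's open stub (so the reshape
weakened the leaf), and — with stubs 2–5 — still gives the crux through this skeleton. -/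
example (hTF : PrimeTwoFamilies) : HomocyclicSTPPDesigns :=
  designs_of_parts (stub_clusteredOfPrimeTwoFamilies hTF) stub_cornerFreeSquares stub_chartPattern
    stub_rowsDesign stub_rowsCount

/-- Typed record: the composition is landed as a tree theorem (p155276), so the crux follows from the
open stub by ONE landed implication. -/
example : HomocyclicSTPPDesigns :=
  Summit.MatrixMultiplication.MatrixMultiplication.Theorems.HomocyclicSTPPDesigns.ClusteredCharts.homocyclicSTPPDesigns_of_clusteredTwoFamilies
    stub_clusteredTwoFamilies

/-- Typed record (kill side, landed p155804 + assembly): `PrimeCyclicPowerGain` refutes the open stub. -/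
example (hPG : PrimeCyclicPowerGain) : False :=
  stub_leafVersusPowerGain stub_leafPacking stub_leafSwap hPG stub_clusteredTwoFamilies


/-! ## Capacity and normal-form calibration (lead c4; all landed, not used by the composition) -/

/-- Typed record (LANDED p159568, `chartCapacity_needDensity`): every fixed-layout design over the
rotated chart of an SDPP family in `ℤ/p` whose CKSU-Thm-37 blocks beat `2 + ε` comes from a DENSE family,
`p² < n² (ab)^{1+ε}` — so STUB 1 cannot be reshaped to a sparser leaf inside this line. -/
example :
    ∀ (p n a b k L : ℕ) (A B : Fin n → Finset (ZMod p)) (cA cB cC : Fin n × Fin 3 → Finset (ZMod p))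
      (role : Fin k → Fin 3) (sym : Fin L → Fin k → Fin n) (ε : ℝ), p.Prime → IsSDPP A B → 1 ≤ a →
      1 ≤ b → (∀ i, (A i).card = a ∧ (B i).card = b) →
      (∀ i, cA (i, 0) = A i) → (∀ i, cA (i, 1) = {0}) → (∀ i, cA (i, 2) = B i) →
      (∀ i, cB (i, 0) = B i) → (∀ i, cB (i, 1) = A i) → (∀ i, cB (i, 2) = {0}) →
      (∀ i, cC (i, 0) = {0}) → (∀ i, cC (i, 1) = B i) → (∀ i, cC (i, 2) = A i) →
      IsLocalChartUSP cA cB cC (fun u c => (sym u c, role c)) →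
      (p : ℝ) ^ k < ∑ u : Fin L, (((chartBlock cA (fun u c => (sym u c, role c)) u).card *
        (chartBlock cB (fun u c => (sym u c, role c)) u).card *
        (chartBlock cC (fun u c => (sym u c, role c)) u).card : ℕ) : ℝ) ^ ((2 + ε) / 3) →
      (p : ℝ) ^ 2 < (n : ℝ) ^ 2 * ((a * b : ℕ) : ℝ) ^ (1 + ε) :=
  Summit.MatrixMultiplication.MatrixMultiplication.Theorems.HomocyclicSTPPDesigns.ClusteredCharts.chartCapacity_needDensity

/-- Typed record (LANDED p159353, `chartCapacity_cube`): the capacity bound itself,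
`L³ · (ab)^k ≤ n^{2k} · p^k` for fixed-layout local chart-USPs over the rotated chart. -/
example :
    ∀ (p n a b k L : ℕ) (A B : Fin n → Finset (ZMod p)) (cA cB cC : Fin n × Fin 3 → Finset (ZMod p))
      (role : Fin k → Fin 3) (sym : Fin L → Fin k → Fin n), p.Prime → IsSDPP A B → 1 ≤ a → 1 ≤ b →
      (∀ i, (A i).card = a ∧ (B i).card = b) →
      (∀ i, cA (i, 0) = A i) → (∀ i, cA (i, 1) = {0}) → (∀ i, cA (i, 2) = B i) →
      (∀ i, cB (i, 0) = B i) → (∀ i, cB (i, 1) = A i) → (∀ i, cB (i, 2) = {0}) →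
      (∀ i, cC (i, 0) = {0}) → (∀ i, cC (i, 1) = B i) → (∀ i, cC (i, 2) = A i) →
      IsLocalChartUSP cA cB cC (fun u c => (sym u c, role c)) →
      L ^ 3 * (a * b) ^ k ≤ n ^ (2 * k) * p ^ k :=
  Summit.MatrixMultiplication.MatrixMultiplication.Theorems.HomocyclicSTPPDesigns.ClusteredCharts.chartCapacity_cube

/-- Typed record (LANDED p159859, `clusteredTwoFamilies_iff_balanced`): STUB 1 is equivalent to its
balanced form `|A_i| = |B_i| = s ≥ 2`, merit `m·d^{2/3}·(s·s)^{(2+ε)/3} > p`; in particular the crux also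
follows from the balanced leaf through the landed reduction. -/
example
    (hBal : ∀ ε : ℝ, 0 < ε → ∃ p : ℕ, p.Prime ∧ ∃ (n m s d : ℕ) (A B : Fin n → Finset (ZMod p))
      (cls : Fin n → Fin m), IsSDPP A B ∧ 2 ≤ s ∧ (∀ i, (A i).card = s ∧ (B i).card = s) ∧
      (∀ i j, cls i ≠ cls j → Disjoint (A i - B i) (A j - B j)) ∧
      (∀ c : Fin m, d ≤ (Finset.univ.filter fun i => cls i = c).card) ∧
      (p : ℝ) < (m : ℝ) * (d : ℝ) ^ ((2 : ℝ) / 3) * ((s * s : ℕ) : ℝ) ^ ((2 + ε) / 3)) :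
    HomocyclicSTPPDesigns :=
  Summit.MatrixMultiplication.MatrixMultiplication.Theorems.HomocyclicSTPPDesigns.ClusteredCharts.homocyclicSTPPDesigns_of_clusteredTwoFamilies
    (Summit.MatrixMultiplication.MatrixMultiplication.Theorems.HomocyclicSTPPDesigns.ClusteredCharts.clusteredTwoFamilies_iff_balanced.2
      hBal)

/-! ## Lead c5 records (all landed, not used by the composition) -/

/-- Typed record (LANDED p165080, `stub_leafNearPeriodPacking`): NEAR-PERIOD PACKING — every `t ∈ ℬ − ℬ` is a
near-period of `⋃ A_i`, whence `K·(2(n−1)a + m·ab) ≤ K·p + (na)²`, `K = min(p, 2nb−1)`; caps the merit constant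
`m³d²s⁴/p³` of STUB 1 witnesses at `16/243 + O(1/n)` (witnesses need `(ab)^ε > 243/16`). -/
example :
    ∀ (p n m a b d : ℕ), p.Prime → ∀ (A B : Fin n → Finset (ZMod p)) (cls : Fin n → Fin m),
      IsSDPP A B → 1 ≤ a → 1 ≤ b → (∀ i, (A i).card = a ∧ (B i).card = b) →
      (∀ i j, cls i ≠ cls j → Disjoint (A i - B i) (A j - B j)) →
      1 ≤ d → (∀ c : Fin m, d ≤ (Finset.univ.filter fun i => cls i = c).card) →
      min p (2 * (n * b) - 1) * (2 * ((n - 1) * a) + m * (a * b)) ≤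
          min p (2 * (n * b) - 1) * p + (n * a) ^ 2 ∧
        min p (2 * (n * a) - 1) * (2 * ((n - 1) * b) + m * (a * b)) ≤
          min p (2 * (n * a) - 1) * p + (n * b) ^ 2 ∧
        (p < 2 * (n * b) → p * (2 * ((n - 1) * a) + m * (a * b)) ≤ p ^ 2 + (n * a) ^ 2) :=
  Summit.MatrixMultiplication.MatrixMultiplication.Theorems.HomocyclicSTPPDesigns.ClusteredCharts.stub_leafNearPeriodPacking

/-- Typed record (LANDED p163945): the by-name glue = item stmt-18135 verbatim. -/
example : LeafGivesDesigns :=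
  Summit.MatrixMultiplication.MatrixMultiplication.Theorems.HomocyclicSTPPDesigns.ClusteredCharts.leafGivesDesigns_holds

/-- Typed record (LANDED p167699, universality programme of the crux strategist gen 2, U2 stubs landed by lead c5's wave):
the crux is EQUIVALENT to `GroupTheoreticSTPP.CThesis` (stmt-0593) and to `AutomaticSTPPDesigns.AutomaticPackingThesis`
(stmt-7356), and the kill sides `NoHomocyclicSTPP` (stmt-7787) / `CAbelianObstructionNeg` (stmt-0595) coincide — so STUB 1
(item 18134) is a sufficient condition for three routes' deciding cruxes at once, and no registered line has a weaker leaf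
than the crux itself. -/
example :
    (Summit.MatrixMultiplication.MatrixMultiplication.Theses.GroupTheoreticSTPP.CThesis ↔ HomocyclicSTPPDesigns) ∧
      (HomocyclicSTPPDesigns ↔
        Summit.MatrixMultiplication.MatrixMultiplication.Theses.AutomaticSTPPDesigns.AutomaticPackingThesis) ∧
      (NoHomocyclicSTPP ↔ Summit.MatrixMultiplication.MatrixMultiplication.Theses.GroupTheoreticSTPP.CAbelianObstructionNeg) :=
  Summit.MatrixMultiplication.MatrixMultiplication.Theorems.HomocyclicSTPPDesigns.Universality.universality_package

end Summit.MatrixMultiplication.MatrixMultiplication.Cruxes.HomocyclicSTPPDesigns.ClusteredCharts
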